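import Mathlib.MeasureTheory.Measure.Lebesgue.Integral
import Mathlib.Analysis.SpecialFunctions.Integrals.Basic
import Mathlib.Analysis.SpecialFunctions.Pow.Asymptotics
import Literature.NumberTheory.LFunctions.MontgomeryTheoremGoldstonMontgomery
import Literature.NumberTheory.LFunctions.AlternativeHypothesis
import HarnessLib

/-!
# BGSTB 2025, (MT-Pairs), second display — PROVED (discharge of `bgstb2025_mtPairs`)

Topic `Literature/NumberTheory/LFunctions` (namespace `Literature.NumberTheory.LFunctions`). PROOF LAYER
for the claim `bgstb2025_mtPairs` of `AlternativeHypothesis.lean` (cell `rh-crit/ah`, C5); theorems only,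
no definitions, no named facts. LABEL: **NOT RH-BEARING** — RH is the printed ANTECEDENT of (MT-Pairs)
(it enters only through Montgomery's theorem (MT)); nothing here bears on the truth of RH.

## What the source prints (held TeX text `paper:arxiv-2508.10857`, §2 (MT-Pairs) and §3, proof)

S. A. C. Baluyot, D. A. Goldston, A. I. Suriajaya, C. L. Turnage-Butterbaugh, *The Alternative Hypothesis
for zeros of the Riemann zeta-function*, arXiv:2508.10857 (2025; UNREFEREED): "(MT-Pairs) Let `g(α)` be
in `L¹(ℝ)`, even, has support in `|α| ≤ 1` and is Lipschitz continuous at `α = 0` … Then, assuming the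
Riemann Hypothesis, we have `∑_{0<γ,γ'≤T} ĝ((γ−γ')/2π · log T) w(γ−γ') = (T/2π) log T ∫ F(α) g(α) dα`,
and `= (T/2π) log T (g(0) + 2∫_0^1 α g(α) dα + O(1/√log T))`." Proof (§3): the first display is the
exchange of the finite sum with the Fourier integral (the tree's unconditional
`AH.sum_fourier_pairSpacing_eq_integral`); for the second, "by (MT),
`∫ F(α) g(α) dα = 2∫_0^1 T^{−2α} log T (1 + O(1/√log T)) g(α) dα + 2∫_0^1 α g(α) dα + O(1/√log T)`.
Using the Lipschitz condition on `g(α)` at `α = 0`, … the first integral … `= g(0) + O(1/√log T)`."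

## What is proved here

* `bgstb2025_mtPairs_holds : bgstb2025_mtPairs` — the claim EXACTLY as typed, from Montgomery's theorem
  with the Goldston–Montgomery error term uniformly on `[0, 1]`
  (`Montgomery.montgomery_pair_correlation_sqrtLog_Icc`, file `MontgomeryTheoremGoldstonMontgomery.lean`)
  and the first display. We follow the printed proof with one simplification: instead of splitting the
  `α`-integral at `log log T/log T` we split the POINTWISE bound at a fixed `δ₁ < δ` (`δ` the Lipschitz
  radius): on `[0, δ₁]`, `|g(α)| ≤ |g(0)| + C` and `|g(α) − g(0)| ≤ Cα`, and
  `log T · α T^{−2α} ≤ T^{−α}`; on `[δ₁, 1]`, `T^{−2α} log T ≤ T^{−2δ₁} log T ≤ 1/√log T` for large `T`.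
  The only calculus input is `∫_0^d e^{−cα} dα = (1 − e^{−cd})/c`.

## References

* [BaluyotGoldstonSuriajayaTurnageButterbaugh2025] arXiv:2508.10857, §2 (MT-Pairs) and §3 (its proof).
  [claim: BaluyotGoldstonSuriajayaTurnageButterbaugh2025, status: under-review]
* [GoldstonMontgomery1987] D. A. Goldston, H. L. Montgomery, *Pair correlation of zeros and primes in
  short intervals*, Progr. Math. 70 (1987), §3, Lemma 8 (the input (MT)).
* [Montgomery1973] H. L. Montgomery, *The pair correlation of zeros of the zeta function*, Theorem.
-/

noncomputable section

open Filter Set MeasureTheory Real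
open scoped Real Topology FourierTransform

namespace Literature.NumberTheory.LFunctions

namespace AH

/-! ## Calculus helpers -/

/-- `∫_0^d e^{−c a} da = (1 − e^{−c d})/c` (`c ≠ 0`). [folklore] -/
private theorem integral_exp_neg_mul {c : ℝ} (hc : c ≠ 0) (d : ℝ) :
    ∫ a in (0 : ℝ)..d, Real.exp (-c * a) = (1 - Real.exp (-c * d)) / c := by
  rw [intervalIntegral.integral_comp_mul_left (fun x ↦ Real.exp x) (neg_ne_zero.2 hc), integral_exp]
  simp only [mul_zero, Real.exp_zero, smul_eq_mul]
  field_simp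
  ring

/-- `∫_0^d e^{−c a} da ≤ 1/c` (`c > 0`, `d` arbitrary). [folklore] -/
private theorem integral_exp_neg_mul_le {c : ℝ} (hc : 0 < c) (d : ℝ) :
    ∫ a in (0 : ℝ)..d, Real.exp (-c * a) ≤ 1 / c := by
  rw [integral_exp_neg_mul hc.ne' d]
  exact div_le_div_of_nonneg_right (by linarith [Real.exp_pos (-c * d)]) hc.le

/-- `L a e^{−2La} ≤ e^{−La}` (from `La ≤ e^{La}`). [folklore] -/
private theorem mul_mul_exp_neg_two_mul_le (L a : ℝ) :
    L * a * Real.exp (-(2 * L) * a) ≤ Real.exp (-L * a) := by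
  have h1 : L * a ≤ Real.exp (L * a) := by linarith [Real.add_one_le_exp (L * a)]
  have e : Real.exp (-L * a) = Real.exp (L * a) * Real.exp (-(2 * L) * a) := by
    rw [← Real.exp_add]; congr 1; ring
  rw [e]
  exact mul_le_mul_of_nonneg_right h1 (Real.exp_pos _).le

/-- `F(·, T)` is continuous (a finite cosine sum). [folklore] -/
private theorem continuous_montgomeryFormFactor_left (T : ℝ) :
    Continuous fun a : ℝ ↦ montgomeryFormFactor a T := by
  unfold montgomeryFormFactor
  fun_prop

/-- `(log T)² ≤ T^ε` for all large `T` (`ε > 0`). [folklore] -/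
private theorem eventually_log_sq_le_rpow {ε : ℝ} (hε : 0 < ε) :
    ∀ᶠ T : ℝ in atTop, Real.log T ^ 2 ≤ T ^ ε := by
  have h := (isLittleO_log_rpow_rpow_atTop (r := 2) hε).bound one_pos
  filter_upwards [h, eventually_ge_atTop 1] with T hT hT1
  have h1 : 0 ≤ Real.log T := Real.log_nonneg hT1
  rw [Real.norm_of_nonneg (Real.rpow_nonneg h1 _), Real.norm_of_nonneg (Real.rpow_nonneg (by linarith) _),
    one_mul, Real.rpow_two] at hT
  exact hT

/-- Folding an even integrand supported in `[−1, 1]`: `∫_ℝ F(a,T) g(a) da = 2 ∫_0^1 F(a,T) g(a) da`.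
[cite: BaluyotGoldstonSuriajayaTurnageButterbaugh2025, §3 (proof of MT-Pairs)] -/
private theorem integral_formFactor_mul_eq_two_mul {g : ℝ → ℝ} (hev : ∀ a, g (-a) = g a)
    (hsupp : ∀ a, 1 < |a| → g a = 0) (T : ℝ) :
    ∫ a, montgomeryFormFactor a T * g a =
      2 * ∫ a in (0 : ℝ)..1, montgomeryFormFactor a T * g a := by
  have h1 : (∫ a, montgomeryFormFactor a T * g a) =
      ∫ a, (fun x ↦ montgomeryFormFactor x T * g x) |a| := by
    congr 1
    ext a
    rcases le_or_gt 0 a with ha | ha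
    · simp only [abs_of_nonneg ha]
    · simp only [abs_of_neg ha, montgomeryFormFactor_neg, hev]
  rw [h1, integral_comp_abs (f := fun x ↦ montgomeryFormFactor x T * g x),
    intervalIntegral.integral_of_le zero_le_one]
  congr 1
  refine setIntegral_eq_of_subset_of_forall_sdiff_eq_zero measurableSet_Ioi Ioc_subset_Ioi_self ?_
  intro x hx
  have hx0 : 0 < x := hx.1
  have hx1 : 1 < x := by
    by_contra h
    exact hx.2 ⟨hx0, not_lt.1 h⟩
  show montgomeryFormFactor x T * g x = 0
  rw [hsupp x (by rwa [abs_of_pos hx0]), mul_zero]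

end AH

open AH in
/-- **BGSTB 2025, (MT-Pairs), second display — PROVED** (discharge of the claim `bgstb2025_mtPairs`
exactly as typed): assuming RH, for `g ∈ L¹(ℝ)` even, supported in `|α| ≤ 1` and Lipschitz at `0`,
there is `C` with `‖∑_{0<γ,γ'≤T} ĝ(((γ−γ')/2π) log T) w(γ−γ') − (T/2π) log T (g(0) + 2∫_0^1 α g(α) dα)‖
≤ C · ((T/2π) log T)/√(log T)` for all large `T`. Inputs: the first display
(`AH.sum_fourier_pairSpacing_eq_integral`, unconditional) and Montgomery's theorem with the
Goldston–Montgomery error term uniformly on `[0, 1]` (`Montgomery.montgomery_pair_correlation_sqrtLog_Icc`).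
[cite: BaluyotGoldstonSuriajayaTurnageButterbaugh2025, §3 (proof of MT-Pairs)] -/
theorem bgstb2025_mtPairs_holds : bgstb2025_mtPairs := by
  intro hRH g hg hev hsupp hLip
  obtain ⟨C₃, hC₃⟩ := Montgomery.montgomery_pair_correlation_sqrtLog_Icc hRH
  obtain ⟨Cg, δ, hδ, hLip⟩ := hLip
  simp only [sub_zero] at hLip
  -- constants depending on `g` only
  set Cg' : ℝ := max Cg 0 with hCg'
  have hCg'0 : 0 ≤ Cg' := le_max_right _ _
  have hCgle : Cg ≤ Cg' := le_max_left _ _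
  set δ₁ : ℝ := min δ 1 / 2 with hδ₁
  have hmin0 : 0 < min δ 1 := lt_min hδ one_pos
  have hδ₁0 : 0 < δ₁ := by rw [hδ₁]; positivity
  have hδ₁δ : δ₁ < δ := by have := min_le_left δ 1; rw [hδ₁]; linarith
  have hδ₁1 : δ₁ ≤ 1 / 2 := by have := min_le_right δ 1; rw [hδ₁]; linarith
  set M₀ : ℝ := |g 0| + Cg' with hM₀
  have hM₀0 : 0 ≤ M₀ := by positivity
  have hgi : IntervalIntegrable g volume (0 : ℝ) 1 := hg.intervalIntegrable
  set N₁ : ℝ := ∫ a in (0 : ℝ)..1, |g a| with hN₁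
  have hN₁0 : 0 ≤ N₁ := intervalIntegral.integral_nonneg zero_le_one fun a _ ↦ abs_nonneg _
  set K₀ : ℝ := 2 * |C₃| * M₀ + (2 * |C₃| + 1) * N₁ + 2 * |g 0| + Cg' with hK₀
  refine ⟨2 * K₀, ?_⟩
  filter_upwards [hC₃, eventually_ge_atTop 3, eventually_log_sq_le_rpow (by positivity : 0 < 2 * δ₁)]
    with T hF hT3 hLT
  have hT0 : 0 < T := by linarith
  have hT1 : 1 < T := by linarith
  set L : ℝ := Real.log T with hL
  have hL1 : 1 ≤ L := by
    rw [hL, ← Real.log_exp 1]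
    exact Real.log_le_log (Real.exp_pos 1) (by linarith [Real.exp_one_lt_d9])
  have hL0 : 0 < L := by linarith
  set s : ℝ := Real.sqrt L with hs
  have hs0 : 0 < s := Real.sqrt_pos.2 hL0
  have hs2 : s ^ 2 = L := Real.sq_sqrt hL0.le
  have hs1 : 1 ≤ s := by rw [hs]; exact Real.one_le_sqrt.2 hL1
  have hsL : s ≤ L := by nlinarith
  have hLT' : L ≤ T := by linarith [Real.log_le_sub_one_of_pos hT0]
  have h1s : 1 / L ≤ 1 / s := div_le_div_of_nonneg_left zero_le_one hs0 hsL
  have hP0 : 0 < T / (2 * π) * L := by positivity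
  -- `E a = T^{-2a}`
  set E : ℝ → ℝ := fun a ↦ Real.exp (-(2 * L) * a) with hEdef
  have hE : ∀ a : ℝ, T ^ (-2 * a) = E a := fun a ↦ by
    rw [hEdef, Real.rpow_def_of_pos hT0]; congr 1; ring
  have hE0 : ∀ a, 0 < E a := fun a ↦ Real.exp_pos _
  have hEmono : ∀ a b : ℝ, a ≤ b → E b ≤ E a := fun a b hab ↦
    Real.exp_le_exp.2 (by nlinarith)
  have hEc : Continuous E := by rw [hEdef]; fun_prop
  -- on `[δ₁, 1]`: `L E(a) ≤ L E(δ₁) ≤ 1/L ≤ 1/s`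
  have hEδ : L * E δ₁ ≤ 1 / s := by
    have h1 : E δ₁ = 1 / T ^ (2 * δ₁) := by
      rw [← hE, show -2 * δ₁ = -(2 * δ₁) by ring, Real.rpow_neg hT0.le, one_div]
    rw [h1]
    have hTp : 0 < T ^ (2 * δ₁) := Real.rpow_pos_of_pos hT0 _
    refine le_trans ?_ h1s
    rw [mul_one_div, div_le_div_iff₀ hTp hL0, one_mul]
    calc L * L = L ^ 2 := by ring
      _ ≤ T ^ (2 * δ₁) := hLT
  have hEδ1 : L * E δ₁ ≤ 1 := hEδ.trans (by rw [div_le_one hs0]; exact hs1)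
  -- pointwise facts about `g` near `0`
  have hgLip : ∀ a : ℝ, 0 ≤ a → a < δ₁ → |g a - g 0| ≤ Cg' * a := by
    intro a ha0 had
    have h := hLip a (by rw [abs_of_nonneg ha0]; linarith)
    rw [abs_of_nonneg ha0] at h
    exact h.trans (mul_le_mul_of_nonneg_right hCgle ha0)
  have hgM : ∀ a : ℝ, 0 ≤ a → a < δ₁ → |g a| ≤ M₀ := by
    intro a ha0 had
    have h := hgLip a ha0 had
    have h2 : Cg' * a ≤ Cg' := by nlinarith
    calc |g a| = |g 0 + (g a - g 0)| := by ring_nf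
      _ ≤ |g 0| + |g a - g 0| := abs_add_le _ _
      _ ≤ |g 0| + Cg' := by linarith
  -- the pointwise majorant `b`
  set b : ℝ → ℝ := fun a ↦ |C₃| * M₀ / s * (L * E a + 1) + (2 * |C₃| + 1) / s * |g a| + |g 0| / s +
      Cg' * Real.exp (-L * a) with hb
  have hpt : ∀ a ∈ Set.Ioc (0 : ℝ) 1,
      ‖montgomeryFormFactor a T * g a - a * g a - g 0 * (L * E a)‖ ≤ b a := by
    intro a ha
    obtain ⟨ha0, ha1⟩ := ha
    have hFa := hF a ⟨ha0.le, ha1⟩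
    rw [hE a] at hFa
    have hLEa0 : 0 < L * E a := mul_pos hL0 (hE0 a)
    have hq0 : 0 ≤ (L * E a + 1) / s := by positivity
    have hFa' : |montgomeryFormFactor a T - (E a * L + a)| ≤ |C₃| * ((L * E a + 1) / s) := by
      refine hFa.trans ?_
      rw [mul_comm (E a) L, ← mul_div_assoc]
      exact div_le_div_of_nonneg_right (mul_le_mul_of_nonneg_right (le_abs_self C₃) (by positivity))
        hs0.le
    rw [Real.norm_eq_abs]
    have esplit : montgomeryFormFactor a T * g a - a * g a - g 0 * (L * E a) =
        (montgomeryFormFactor a T - (E a * L + a)) * g a + L * E a * (g a - g 0) := by ring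
    rw [esplit]
    refine (abs_add_le _ _).trans ?_
    rw [abs_mul, abs_mul, abs_of_pos hLEa0]
    have hb' : b a = |C₃| * M₀ / s * (L * E a + 1) + (2 * |C₃| + 1) / s * |g a| + |g 0| / s +
        Cg' * Real.exp (-L * a) := rfl
    rw [hb']
    have hn1 : 0 ≤ (2 * |C₃| + 1) / s * |g a| := by positivity
    have hn2 : 0 ≤ |g 0| / s := by positivity
    have hn3 : 0 ≤ |C₃| * M₀ / s * (L * E a + 1) := by positivity
    have hn4 : 0 ≤ Cg' * Real.exp (-L * a) := by positivity
    have hn5 : 0 ≤ |g a| / s := by positivity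
    rcases lt_or_ge a δ₁ with had | had
    · -- near `0`: `|g| ≤ M₀`, `|g(a) − g(0)| ≤ C a`, `L a e^{−2La} ≤ e^{−La}`
      have t1 : |montgomeryFormFactor a T - (E a * L + a)| * |g a| ≤
          |C₃| * ((L * E a + 1) / s) * M₀ :=
        mul_le_mul hFa' (hgM a ha0.le had) (abs_nonneg _) (by positivity)
      have t2 : L * E a * |g a - g 0| ≤ Cg' * Real.exp (-L * a) := by
        calc L * E a * |g a - g 0| ≤ L * E a * (Cg' * a) :=
              mul_le_mul_of_nonneg_left (hgLip a ha0.le had) hLEa0.le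
          _ = Cg' * (L * a * Real.exp (-(2 * L) * a)) := by rw [hEdef]; ring
          _ ≤ Cg' * Real.exp (-L * a) :=
              mul_le_mul_of_nonneg_left (mul_mul_exp_neg_two_mul_le L a) hCg'0
      have e1 : |C₃| * ((L * E a + 1) / s) * M₀ = |C₃| * M₀ / s * (L * E a + 1) := by ring
      linarith
    · -- away from `0`: `L E(a) ≤ 1/s ≤ 1`
      have hLEa : L * E a ≤ 1 / s := (mul_le_mul_of_nonneg_left (hEmono _ _ had) hL0.le).trans hEδ
      have hLEa1 : L * E a ≤ 1 := (mul_le_mul_of_nonneg_left (hEmono _ _ had) hL0.le).trans hEδ1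
      have t1 : |montgomeryFormFactor a T - (E a * L + a)| * |g a| ≤ |C₃| * (2 / s) * |g a| := by
        refine mul_le_mul_of_nonneg_right (hFa'.trans ?_) (abs_nonneg _)
        refine mul_le_mul_of_nonneg_left ?_ (abs_nonneg _)
        exact div_le_div_of_nonneg_right (by linarith) hs0.le
      have t2 : L * E a * |g a - g 0| ≤ 1 / s * (|g a| + |g 0|) :=
        mul_le_mul hLEa (abs_sub _ _) (abs_nonneg _) (by positivity)
      have e1 : |C₃| * (2 / s) * |g a| + 1 / s * (|g a| + |g 0|) =
          (2 * |C₃| + 1) / s * |g a| + |g 0| / s := by ring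
      linarith
  -- integrability on `[0, 1]`
  have hFgi : IntervalIntegrable (fun a ↦ montgomeryFormFactor a T * g a) volume 0 1 :=
    hgi.continuousOn_mul (continuous_montgomeryFormFactor_left T).continuousOn
  have hagi : IntervalIntegrable (fun a : ℝ ↦ a * g a) volume 0 1 :=
    hgi.continuousOn_mul continuous_id.continuousOn
  have hEgi : IntervalIntegrable (fun a ↦ g 0 * (L * E a)) volume 0 1 :=
    ((hEc.const_mul L).const_mul (g 0)).intervalIntegrable _ _
  have hEi : IntervalIntegrable E volume 0 1 := hEc.intervalIntegrable _ _
  have hexpi : IntervalIntegrable (fun a ↦ Real.exp (-L * a)) volume 0 1 :=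
    (by fun_prop : Continuous fun a ↦ Real.exp (-L * a)).intervalIntegrable _ _
  have hb1i : IntervalIntegrable (fun a ↦ |C₃| * M₀ / s * (L * E a + 1)) volume 0 1 :=
    ((hEc.const_mul L).add continuous_const |>.const_mul _).intervalIntegrable _ _
  have hb2i : IntervalIntegrable (fun a ↦ (2 * |C₃| + 1) / s * |g a|) volume 0 1 :=
    hgi.abs.const_mul _
  have hb3i : IntervalIntegrable (fun _ : ℝ ↦ |g 0| / s) volume 0 1 := intervalIntegrable_const
  have hb4i : IntervalIntegrable (fun a ↦ Cg' * Real.exp (-L * a)) volume 0 1 := hexpi.const_mul _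
  have hbi : IntervalIntegrable b volume 0 1 := by
    rw [hb]; exact ((hb1i.add hb2i).add hb3i).add hb4i
  -- the two exponential integrals
  have hIE : ∫ a in (0 : ℝ)..1, E a ≤ 1 / (2 * L) := by
    rw [hEdef]; exact integral_exp_neg_mul_le (by positivity) 1
  have hIE' : L * ∫ a in (0 : ℝ)..1, E a = (1 - Real.exp (-(2 * L))) / 2 := by
    rw [hEdef, integral_exp_neg_mul (by positivity : (2 * L) ≠ 0) 1, mul_one]
    field_simp
  have hIexp : ∫ a in (0 : ℝ)..1, Real.exp (-L * a) ≤ 1 / L := integral_exp_neg_mul_le hL0 1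
  -- `∫_0^1 b ≤ (K₀ − |g 0|)/s`
  have hIb : ∫ a in (0 : ℝ)..1, b a =
      |C₃| * M₀ / s * (L * (∫ a in (0 : ℝ)..1, E a) + 1) + (2 * |C₃| + 1) / s * N₁ + |g 0| / s +
        Cg' * ∫ a in (0 : ℝ)..1, Real.exp (-L * a) := by
    rw [hb, intervalIntegral.integral_add ((hb1i.add hb2i).add hb3i) hb4i,
      intervalIntegral.integral_add (hb1i.add hb2i) hb3i, intervalIntegral.integral_add hb1i hb2i,
      intervalIntegral.integral_const_mul, intervalIntegral.integral_const_mul,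
      intervalIntegral.integral_const_mul, intervalIntegral.integral_const,
      intervalIntegral.integral_add (hEi.const_mul L) intervalIntegrable_const,
      intervalIntegral.integral_const_mul, intervalIntegral.integral_const]
    simp only [sub_zero, one_smul, hN₁]
  have hIb_le : ∫ a in (0 : ℝ)..1, b a ≤ (2 * |C₃| * M₀ + (2 * |C₃| + 1) * N₁ + |g 0| + Cg') / s := by
    rw [hIb]
    have h1 : L * (∫ a in (0 : ℝ)..1, E a) + 1 ≤ 2 := by
      have : L * (∫ a in (0 : ℝ)..1, E a) ≤ L * (1 / (2 * L)) := mul_le_mul_of_nonneg_left hIE hL0.le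
      rw [show L * (1 / (2 * L)) = 1 / 2 by field_simp] at this
      linarith
    have h2 : |C₃| * M₀ / s * (L * (∫ a in (0 : ℝ)..1, E a) + 1) ≤ |C₃| * M₀ / s * 2 :=
      mul_le_mul_of_nonneg_left h1 (by positivity)
    have h3 : Cg' * ∫ a in (0 : ℝ)..1, Real.exp (-L * a) ≤ Cg' * (1 / s) :=
      mul_le_mul_of_nonneg_left (hIexp.trans h1s) hCg'0
    have e : (2 * |C₃| * M₀ + (2 * |C₃| + 1) * N₁ + |g 0| + Cg') / s =
        |C₃| * M₀ / s * 2 + (2 * |C₃| + 1) / s * N₁ + |g 0| / s + Cg' * (1 / s) := by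
      field_simp
    rw [e]
    linarith
  -- the integral of the left-hand side
  have hLHS : ∫ a in (0 : ℝ)..1, (montgomeryFormFactor a T * g a - a * g a - g 0 * (L * E a)) =
      (∫ a in (0 : ℝ)..1, montgomeryFormFactor a T * g a) - (∫ a in (0 : ℝ)..1, a * g a) -
        g 0 * (L * ∫ a in (0 : ℝ)..1, E a) := by
    rw [intervalIntegral.integral_sub (hFgi.sub hagi) hEgi, intervalIntegral.integral_sub hFgi hagi,
      intervalIntegral.integral_const_mul, intervalIntegral.integral_const_mul]
  have hnorm : ‖∫ a in (0 : ℝ)..1, (montgomeryFormFactor a T * g a - a * g a - g 0 * (L * E a))‖ ≤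
      ∫ a in (0 : ℝ)..1, b a :=
    intervalIntegral.norm_integral_le_of_norm_le zero_le_one (Eventually.of_forall hpt) hbi
  rw [Real.norm_eq_abs, hLHS, hIE'] at hnorm
  -- `e^{−2L} ≤ 1/s`
  have hexp2 : Real.exp (-(2 * L)) ≤ 1 / s := by
    have h1 : Real.exp (-(2 * L)) ≤ Real.exp (-L) := Real.exp_le_exp.2 (by linarith)
    have h2 : Real.exp (-L) = 1 / T := by
      rw [Real.exp_neg, hL, Real.exp_log hT0, one_div]
    have h3 : 1 / T ≤ 1 / L := div_le_div_of_nonneg_left zero_le_one hL0 hLT'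
    linarith
  -- the key estimate `|∫ F g − (g 0 + 2 ∫ α g)| ≤ 2 K₀/s`
  have hI := integral_formFactor_mul_eq_two_mul hev hsupp T
  have key : |(∫ a, montgomeryFormFactor a T * g a) - (g 0 + 2 * ∫ a in (0 : ℝ)..1, a * g a)| ≤
      2 * K₀ / s := by
    rw [hI]
    have e : 2 * (∫ a in (0 : ℝ)..1, montgomeryFormFactor a T * g a) -
        (g 0 + 2 * ∫ a in (0 : ℝ)..1, a * g a) =
        2 * ((∫ a in (0 : ℝ)..1, montgomeryFormFactor a T * g a) - (∫ a in (0 : ℝ)..1, a * g a) -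
          g 0 * ((1 - Real.exp (-(2 * L))) / 2)) - g 0 * Real.exp (-(2 * L)) := by ring
    rw [e]
    have hg0 : |g 0 * Real.exp (-(2 * L))| ≤ |g 0| / s := by
      rw [abs_mul, abs_of_pos (Real.exp_pos _)]
      calc |g 0| * Real.exp (-(2 * L)) ≤ |g 0| * (1 / s) :=
            mul_le_mul_of_nonneg_left hexp2 (abs_nonneg _)
        _ = |g 0| / s := by ring
    have habs2 : |2 * ((∫ a in (0 : ℝ)..1, montgomeryFormFactor a T * g a) -
        (∫ a in (0 : ℝ)..1, a * g a) - g 0 * ((1 - Real.exp (-(2 * L))) / 2))| ≤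
        2 * ((2 * |C₃| * M₀ + (2 * |C₃| + 1) * N₁ + |g 0| + Cg') / s) := by
      rw [abs_mul, abs_two]
      exact mul_le_mul_of_nonneg_left (hnorm.trans hIb_le) zero_le_two
    have eK : 2 * K₀ / s =
        2 * ((2 * |C₃| * M₀ + (2 * |C₃| + 1) * N₁ + |g 0| + Cg') / s) + 2 * (|g 0| / s) := by
      rw [hK₀]; field_simp; ring
    rw [eK]
    refine (abs_sub _ _).trans ?_
    have : 0 ≤ |g 0| / s := by positivity
    linarith
  -- assemble
  rw [sum_fourier_pairSpacing_eq_integral g hg hT1, ← Complex.ofReal_sub, Complex.norm_real,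
    Real.norm_eq_abs, ← mul_sub, abs_mul, abs_of_pos hP0]
  calc T / (2 * π) * L * |(∫ a, montgomeryFormFactor a T * g a) -
        (g 0 + 2 * ∫ a in (0 : ℝ)..1, a * g a)|
      ≤ T / (2 * π) * L * (2 * K₀ / s) := mul_le_mul_of_nonneg_left key hP0.le
    _ = 2 * K₀ * (T / (2 * π) * L) / s := by ring

end Literature.NumberTheory.LFunctions

end
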